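import Mathlib
import Summits.ValiantsHypothesis.ValiantsHypothesis.Theorems.TwoProducts.Negative.CommonPadding
import HarnessLib

/-!
# NEGATIVE lane (val-neg-1 g5): SHALLOW common digit padding — cells kept with the new letters ABOVE, and the digit cap

Helper file for crux `stmt-ValiantsHypothesis-5906` (filed `--supports`; closes NO item, proves NO summit statement, does NOT prove
`TwoProducts`, `PlanarCellBound`, `CellLaw`, `HugeCapCellLaw`, any `ResidualLawV…` or VP ≠ VNP; 0 `def`s).

(1) `isCellFamily_append_common_above`: pointwise twin of `CommonPadding.isCellFamily_append_common` with the inequalities reversed — a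
common padding `w` whose letters lie strictly ABOVE every old letter for the cell witnesses, and are ordered among themselves by one fixed
relation `Q` for those witnesses, keeps `S` a cell family (one explicit order).
(2) `support_monomialSum` / `digitFactor_norm`: the digit factors `w_j = Σ_{d=1}^{t} X^{d (t+1)^j s}` are normalised and `t`-sparse.
(3) `digit_nsmul_mem_blockSet` / `digit_cap_card`: base-`(t+1)` digits — every `k • s`, `k < (t+1)^g`, is a tuple sum of the padded family, so
a set containing all `k • s` (`1 ≤ k < (t+1)^g`) has `≥ (t+1)^g − 1` elements.
(4) `cap_threshold`, `cap_cost`: with `g = 3(m + 4(Lg+1))`, `t + 2 < 2^{Lg+1}`, `2^{Lg} ≤ t+2`: `2^{m+g}(t+2)^4 + 2 ≤ (t+1)^g` and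
`2^{a(m+g)}(t+2)^b ≤ 2^{4am}(t+2)^{b+24a}`.
Used in `Negative/HugeCapResidual.lean` (idea-34's cap manufacture K3, ONE-ray version, in kernel form).  [folklore]
-/

namespace Summit.ValiantsHypothesis.Theorems.TwoProducts.Negative.ShallowPadding

open Finset MvPolynomial
open Summit.ValiantsHypothesis.ValiantsHypothesis.Theorems.NewtonUnitEquations.TwoProducts.FormalLogLinearisation
open Summit.ValiantsHypothesis.ValiantsHypothesis.Theorems.NewtonUnitEquations.TwoProducts.PlanarCell
open Summit.ValiantsHypothesis.Theorems.TwoProducts.Negative.CommonPadding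

variable {m k g : ℕ}

/-! ### (1) Common padding with the new letters above the old ones (pointwise witnesses) -/

/-- **Cells are kept under a common padding whose letters lie ABOVE the old letters for the cell witnesses.**  For each `l ∈ S` a witness
`ξ` is required which is valid for both families, makes `l` the strict top, induces `R` on the old letters, puts every new letter strictly
above every old letter, and induces `Q` on the new letters; then one explicit relation makes `S` a cell family of the padded pair. [folklore] -/
theorem isCellFamily_append_common_above (u v : Fin m → MvPolynomial (Fin 2) ℂ) (w : Fin k → MvPolynomial (Fin 2) ℂ)
    (Q R : Expo → Expo → Prop) (S : Finset Expo)
    (hS : ∀ l ∈ S, ∃ ξ : Fin 2 → ℝ, ValidWeight u v ξ ∧ ValidWeight w w ξ ∧ IsStrictTop ξ (logSupport u v) l ∧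
      (∀ e ∈ tailSupport u v, ∀ e' ∈ tailSupport u v, (R e e' ↔ wt ξ e ≤ wt ξ e')) ∧
      (∀ e ∈ tailSupport u v, ∀ e' ∈ tailSupport w w, wt ξ e < wt ξ e') ∧
      (∀ e ∈ tailSupport w w, ∀ e' ∈ tailSupport w w, (Q e e' ↔ wt ξ e ≤ wt ξ e'))) :
    IsCellFamily (Fin.append u w) (Fin.append v w)
      (fun e e' => (e' ∈ tailSupport u v → e ∈ tailSupport u v ∧ R e e') ∧
        (e' ∉ tailSupport u v → e ∈ tailSupport u v ∨ Q e e')) S := by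
  intro l hl
  obtain ⟨ξ, hval, hvalw, htop, hR, habove, hQ⟩ := hS l hl
  refine ⟨ξ, (validWeight_append_iff u v w w ξ).2 ⟨hval, hvalw⟩, ?_, ?_⟩
  · rwa [logSupport_append_common]
  · intro e he e' he'
    rw [tailSupport_append, Finset.mem_union] at he he'
    by_cases heT' : e' ∈ tailSupport u v
    · by_cases heT : e ∈ tailSupport u v
      · -- old / old
        simp only [heT, heT', true_and, forall_true_left, not_true_eq_false, IsEmpty.forall_iff, and_true]
        exact hR e heT e' heT'
      · -- new `e` / old `e'` : `e'` is strictly below `e`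
        have heN : e ∈ tailSupport w w := he.resolve_left heT
        have hlt := habove e' heT' e heN
        simp only [heT, heT', false_and, forall_true_left, not_true_eq_false, IsEmpty.forall_iff, and_true,
          false_iff, not_le]
        exact hlt
    · by_cases heT : e ∈ tailSupport u v
      · -- old `e` / new `e'`
        have he'N : e' ∈ tailSupport w w := he'.resolve_left heT'
        have hlt := habove e heT e' he'N
        simp only [heT, heT', IsEmpty.forall_iff, not_false_eq_true, true_or, forall_true_left, and_self,
          true_iff]
        exact hlt.le
      · -- new / new
        have heN : e ∈ tailSupport w w := he.resolve_left heT
        have he'N : e' ∈ tailSupport w w := he'.resolve_left heT'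
        simp only [heT, heT', IsEmpty.forall_iff, not_false_eq_true, false_or, forall_true_left, true_and]
        exact hQ e heN e' he'N

/-! ### (2) Sums of distinct monic monomials -/

/-- The coefficients of `Σ_{e ∈ E} X^e`. [folklore] -/
theorem coeff_monomialSum (E : Finset Expo) (n : Expo) :
    coeff n (∑ e ∈ E, monomial e (1 : ℂ)) = if n ∈ E then 1 else 0 := by
  classical
  rw [coeff_sum]
  simp only [coeff_monomial]
  rw [Finset.sum_ite_eq']

/-- The support of `Σ_{e ∈ E} X^e` is `E`. [folklore] -/
theorem support_monomialSum (E : Finset Expo) : (∑ e ∈ E, monomial e (1 : ℂ)).support = E := by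
  classical
  ext n
  rw [mem_support_iff, coeff_monomialSum]
  split_ifs with h
  · simp [h]
  · simp [h]

/-- `Σ_{e ∈ E} X^e` is normalised and `t`-sparse when `0 ∉ E` and `#E ≤ t`. [folklore] -/
theorem monomialSum_norm {t : ℕ} (E : Finset Expo) (h0 : (0 : Expo) ∉ E) (hE : E.card ≤ t) :
    coeff 0 (∑ e ∈ E, monomial e (1 : ℂ)) = 0 ∧ (∑ e ∈ E, monomial e (1 : ℂ)).support.card ≤ t := by
  classical
  refine ⟨?_, by rwa [support_monomialSum]⟩
  rw [coeff_monomialSum, if_neg h0]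

/-- The digit letter set of position `j`: `{d (t+1)^j • s : 1 ≤ d ≤ t}` has `t` elements and misses `0`. [folklore] -/
theorem digitLetters_card {t : ℕ} {s : Expo} (hs0 : s ≠ 0) (j : ℕ) :
    (0 : Expo) ∉ (Finset.Icc 1 t).image (fun d => (d * (t + 1) ^ j) • s) ∧
    ((Finset.Icc 1 t).image (fun d => (d * (t + 1) ^ j) • s)).card = t := by
  constructor
  · rw [Finset.mem_image]
    rintro ⟨d, hd, hd0⟩
    rw [Finset.mem_Icc] at hd
    have hne : d * (t + 1) ^ j ≠ 0 := Nat.mul_ne_zero (by omega) (pow_ne_zero _ (by omega))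
    rw [← zero_smul ℕ s] at hd0
    exact nsmul_ne_nsmul hs0 hne hd0
  · rw [Finset.card_image_of_injOn, Nat.card_Icc, Nat.add_sub_cancel]
    intro d _ d' _ h
    by_contra hne
    have hpos : 0 < (t + 1) ^ j := by positivity
    exact nsmul_ne_nsmul hs0 (fun h' => hne (Nat.eq_of_mul_eq_mul_right hpos h')) h

/-- **The digit factors are normalised and `t`-sparse.** [folklore] -/
theorem digitFactor_norm {t : ℕ} {s : Expo} (hs0 : s ≠ 0) (w : Fin g → MvPolynomial (Fin 2) ℂ)
    (hw : w = fun j : Fin g => ∑ e ∈ (Finset.Icc 1 t).image (fun d => (d * (t + 1) ^ (j : ℕ)) • s), monomial e (1 : ℂ)) :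
    ∀ j, coeff 0 (w j) = 0 ∧ (w j).support.card ≤ t := by
  intro j
  subst hw
  obtain ⟨h0, hc⟩ := digitLetters_card (t := t) hs0 (j : ℕ)
  exact monomialSum_norm _ h0 hc.le

/-- **The letters of the digit padding**: `tailSupport w w` is the union of the digit letter sets; every letter is `k • s` with
`1 ≤ k < (t+1)^g`. [folklore] -/
theorem digit_tailSupport {t : ℕ} {s : Expo} (w : Fin g → MvPolynomial (Fin 2) ℂ)
    (hw : w = fun j : Fin g => ∑ e ∈ (Finset.Icc 1 t).image (fun d => (d * (t + 1) ^ (j : ℕ)) • s), monomial e (1 : ℂ)) :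
    ∀ e ∈ tailSupport w w, ∃ k : ℕ, 1 ≤ k ∧ k < (t + 1) ^ g ∧ e = k • s := by
  classical
  intro e he
  subst hw
  unfold tailSupport at he
  simp only [Finset.union_idempotent, Finset.mem_biUnion, Finset.mem_univ, true_and, support_monomialSum,
    Finset.mem_image, Finset.mem_Icc] at he
  obtain ⟨j, d, ⟨hd1, hdt⟩, rfl⟩ := he
  refine ⟨d * (t + 1) ^ (j : ℕ), ?_, ?_, rfl⟩
  · exact Nat.one_le_iff_ne_zero.2 (by positivity)
  · have hj : (j : ℕ) + 1 ≤ g := j.isLt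
    calc d * (t + 1) ^ (j : ℕ) < (t + 1) * (t + 1) ^ (j : ℕ) := by
          apply Nat.mul_lt_mul_of_pos_right (by omega) (by positivity)
      _ = (t + 1) ^ ((j : ℕ) + 1) := by ring
      _ ≤ (t + 1) ^ g := Nat.pow_le_pow_right (by omega) hj

/-- The digit letter `d (t+1)^j • s` (`1 ≤ d ≤ t`) lies in the support of `w j`. [folklore] -/
theorem digit_mem_support {t : ℕ} {s : Expo} (w : Fin g → MvPolynomial (Fin 2) ℂ)
    (hw : w = fun j : Fin g => ∑ e ∈ (Finset.Icc 1 t).image (fun d => (d * (t + 1) ^ (j : ℕ)) • s), monomial e (1 : ℂ))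
    (j : Fin g) {d : ℕ} (hd1 : 1 ≤ d) (hdt : d ≤ t) : (d * (t + 1) ^ (j : ℕ)) • s ∈ (w j).support := by
  subst hw
  rw [support_monomialSum, Finset.mem_image]
  exact ⟨d, Finset.mem_Icc.2 ⟨hd1, hdt⟩, rfl⟩

/-! ### (3) Base-`(t+1)` digits: every `k • s`, `k < (t+1)^g`, is a tuple sum of the padded family -/

/-- Block sums over `univ` of an appended tuple. [folklore] -/
theorem sum_append_univ (a : Fin m → Expo) (c : Fin g → Expo) : ∑ j, Fin.append a c j = ∑ j, a j + ∑ i, c i := by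
  rw [Fin.sum_univ_add]
  simp only [Fin.append_left, Fin.append_right]

/-- **Digit tuples**: if position `natAdd m j` of the letter family `M` offers all digit letters `d (t+1)^j • s` (`1 ≤ d ≤ t`), then every
`k • s` with `k < (t+1)^g` is a tuple sum over all positions (old positions contribute `0`). [folklore] -/
theorem digit_nsmul_mem_blockSet {t : ℕ} (M : Fin (m + g) → Finset Expo) {s : Expo}
    (hM : ∀ (j : Fin g) (d : ℕ), 1 ≤ d → d ≤ t → (d * (t + 1) ^ (j : ℕ)) • s ∈ M (Fin.natAdd m j))
    (k : ℕ) (hk : k < (t + 1) ^ g) : k • s ∈ blockSet M Finset.univ := by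
  classical
  -- digits of `k`
  set f : Fin g → Fin (t + 1) := finFunctionFinEquiv.symm ⟨k, hk⟩ with hf
  have hkf : (finFunctionFinEquiv f : ℕ) = k := by rw [hf, Equiv.apply_symm_apply]
  let tup : Fin (m + g) → Expo := Fin.append (0 : Fin m → Expo) (fun j : Fin g => ((f j : ℕ) * (t + 1) ^ (j : ℕ)) • s)
  have htup : tup ∈ tuples M := by
    rw [tuples, Fintype.mem_piFinset]
    intro j
    induction j using Fin.addCases with
    | left j => simp [tup]
    | right j =>
      simp only [tup, Fin.append_right]
      rcases Nat.eq_zero_or_pos (f j : ℕ) with h0 | hpos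
      · rw [h0, zero_mul, zero_smul]; exact Finset.mem_insert_self _ _
      · exact Finset.mem_insert_of_mem (hM j _ hpos (by have := (f j).isLt; omega))
  rw [blockSet, Finset.mem_image]
  refine ⟨tup, htup, ?_⟩
  rw [sum_append_univ]
  simp only [Pi.zero_apply, Finset.sum_const_zero, zero_add]
  rw [← Finset.sum_smul, ← hkf, finFunctionFinEquiv_apply]

/-- **The digit cap count**: a finite set containing every `k • s` (`1 ≤ k < K`) has at least `K − 1` elements (`s ≠ 0`). [folklore] -/
theorem digit_cap_card {s : Expo} (hs0 : s ≠ 0) (K : ℕ) (X : Finset Expo) (hX : ∀ k, 1 ≤ k → k < K → k • s ∈ X) :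
    K - 1 ≤ X.card := by
  classical
  have hsub : (Finset.Ico 1 K).image (fun k => k • s) ⊆ X := by
    intro e he
    obtain ⟨k, hk, rfl⟩ := Finset.mem_image.1 he
    rw [Finset.mem_Ico] at hk
    exact hX k hk.1 hk.2
  have hcard : ((Finset.Ico 1 K).image (fun k => k • s)).card = K - 1 := by
    rw [Finset.card_image_of_injective _ (fun a b h => by by_contra hne; exact nsmul_ne_nsmul hs0 hne h), Nat.card_Ico]
  rw [← hcard]
  exact Finset.card_le_card hsub

/-! ### (4) Arithmetic: digit threshold and exponent bookkeeping -/

/-- **Digit threshold**: `2^{m+g}(t+2)^4 + 2 ≤ (t+1)^g` for `g = 3(m + 4(Lg+1))`, `t ≥ 2`, `t + 2 < 2^{Lg+1}`. [folklore] -/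
theorem cap_threshold {t Lg : ℕ} (ht : 2 ≤ t) (hL : t + 2 < 2 ^ (Lg + 1)) (hg : g = 3 * (m + 4 * (Lg + 1))) :
    2 ^ (m + g) * (t + 2) ^ 4 + 2 ≤ (t + 1) ^ g := by
  subst hg
  set h := m + 4 * (Lg + 1) with hh
  -- `(t+1)^3 ≥ 16`, so `(t+1)^{3h} ≥ 16^h = 2^{3h} · 2^h`
  have h16 : 16 ≤ (t + 1) ^ 3 := by
    calc (16 : ℕ) ≤ 3 ^ 3 := by norm_num
      _ ≤ (t + 1) ^ 3 := Nat.pow_le_pow_left (by omega) 3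
  have hpow : 2 ^ (3 * h) * 2 ^ h ≤ (t + 1) ^ (3 * h) := by
    have e1 : 2 ^ (3 * h) * 2 ^ h = 16 ^ h := by
      rw [pow_mul, ← mul_pow]
      norm_num
    rw [e1, pow_mul]
    exact Nat.pow_le_pow_left h16 h
  -- `2^h = 2^m · (2^{Lg+1})^4 ≥ 2^m ((t+2)^4 + 1)`
  have h2h : 2 ^ m * ((t + 2) ^ 4 + 1) ≤ 2 ^ h := by
    rw [hh, pow_add, pow_mul]
    apply Nat.mul_le_mul_left
    have h3 : t + 3 ≤ 2 ^ (Lg + 1) := hL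
    calc (t + 2) ^ 4 + 1 ≤ (t + 3) ^ 4 := by nlinarith
      _ ≤ (2 ^ (Lg + 1)) ^ 4 := Nat.pow_le_pow_left h3 4
      _ = (2 ^ 4) ^ (Lg + 1) := by rw [← pow_mul, ← pow_mul, mul_comm]
  have h2m : 2 ≤ 2 ^ m * 2 ^ (3 * h) := by
    calc (2 : ℕ) = 1 * 2 ^ 1 := by norm_num
      _ ≤ 2 ^ m * 2 ^ (3 * h) := Nat.mul_le_mul Nat.one_le_two_pow (Nat.pow_le_pow_right (by norm_num) (by omega))
  calc 2 ^ (m + 3 * h) * (t + 2) ^ 4 + 2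
      ≤ 2 ^ (m + 3 * h) * (t + 2) ^ 4 + 2 ^ m * 2 ^ (3 * h) := by omega
    _ = 2 ^ (3 * h) * (2 ^ m * ((t + 2) ^ 4 + 1)) := by rw [pow_add]; ring
    _ ≤ 2 ^ (3 * h) * 2 ^ h := Nat.mul_le_mul_left _ h2h
    _ ≤ (t + 1) ^ (3 * h) := hpow

/-- **Exponent bookkeeping**: `2^{a(m+g)}(t+2)^b ≤ 2^{4am}(t+2)^{b+24a}` for `g = 3(m + 4(Lg+1))`, `2^{Lg} ≤ t + 2`. [folklore] -/
theorem cap_cost {t Lg : ℕ} (a b : ℕ) (hL : 2 ^ Lg ≤ t + 2) (hg : g = 3 * (m + 4 * (Lg + 1))) :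
    2 ^ (a * (m + g)) * (t + 2) ^ b ≤ 2 ^ (4 * a * m) * (t + 2) ^ (b + 24 * a) := by
  subst hg
  have ht2 : 2 ≤ t + 2 := by omega
  have hL' : 2 ^ (Lg + 1) ≤ (t + 2) ^ 2 := by
    rw [pow_succ, pow_two]
    exact Nat.mul_le_mul hL ht2
  have key : 2 ^ (a * (12 * (Lg + 1))) ≤ (t + 2) ^ (24 * a) := by
    rw [show a * (12 * (Lg + 1)) = (Lg + 1) * (12 * a) from by ring, pow_mul 2 (Lg + 1) (12 * a),
      show 24 * a = 2 * (12 * a) from by ring, pow_mul (t + 2) 2 (12 * a)]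
    exact Nat.pow_le_pow_left hL' _
  calc 2 ^ (a * (m + 3 * (m + 4 * (Lg + 1)))) * (t + 2) ^ b
      = 2 ^ (4 * a * m) * (2 ^ (a * (12 * (Lg + 1))) * (t + 2) ^ b) := by
        rw [← mul_assoc, ← pow_add]; congr 2; ring
    _ ≤ 2 ^ (4 * a * m) * ((t + 2) ^ (24 * a) * (t + 2) ^ b) :=
        Nat.mul_le_mul_left _ (Nat.mul_le_mul_right _ key)
    _ = 2 ^ (4 * a * m) * (t + 2) ^ (b + 24 * a) := by rw [← pow_add]; ring

end Summit.ValiantsHypothesis.Theorems.TwoProducts.Negative.ShallowPadding
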